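import Mathlib
import Summits.ABC.ABC.Theorems.SoloInformedOnePrime
import Summits.ABC.ABC.Theorems.SoloInformedOnePrimeSubgroup

/-!
# Solo (informed) — (F5) on a set of growing index

Analytic assembly for `SoloInformedOnePrimeSubgroup`: under the subgroup-restricted
two-`p`-adic-logarithm bound (hypothesis `hH`, main term `C·ord_p(2)·log(max u v)·log(2 max u v)/(log p)^2`
for pairs `(2u/v, u/v)` with `u/v ∈ ⟨2⟩ mod p`), the one-prime abc prediction
`W(p)·log p ≤ ε·e_p·log 2 + K_ε` holds for every odd prime `p` whose residual index
`i_p = (p-1)/e_p` satisfies `(log i_p)^4 ≤ δ_ε·log p` — a set of primes of *growing* index, whereas a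
bound with the factor `p - 1` (Yamada 2010) only reaches bounded index
(`soloInformed_onePrime_boundedIndex_of_twoLogBound`). The proof combines the pigeonhole in
`(ℤ/p)ˣ/⟨2⟩`, the dyadic Bertrand family (`log Q = O((log i_p)^2)`), the trivial bound
`W·log p < e_p·log 2` for small `p`, and elementary inequalities. The exponent `4` and the
constants are not optimised (with the prime number theorem one gets `i_p ≤ exp(c √(log p)/log log p)`).
-/

namespace Summit.ABC.ABC.Theorems

open Finset

/-- Elementary: `4 x ≤ x^4 + 3` (AM–GM; `x^4 - 4x + 3 = (x-1)^2 (x^2+2x+3)`). -/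
theorem soloInformed_four_mul_le_pow_four_add_three (x : ℝ) : 4 * x ≤ x ^ 4 + 3 := by
  nlinarith [sq_nonneg (x - 1), sq_nonneg (x + 1), sq_nonneg (x ^ 2 - 1), sq_nonneg x]

set_option maxHeartbeats 800000 in
/-- **(F5) on a set of growing index, from the subgroup-restricted two-logarithm bound.**
Under hypothesis `hH` (as in `soloInformed_wieferichExp_le_of_subgroupTwoLogBound`, with
`C, C' ≥ 0`): for every `ε > 0` there are `δ > 0` and `K` such that
`W(p)·log p ≤ ε·e_p·log 2 + K` for every odd prime `p` whose residual index `i_p = (p-1)/e_p`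
satisfies `(log i_p)^4 ≤ δ·log p`. (Yamada's bound gives this only for bounded `i_p`.) -/
theorem soloInformed_onePrime_growingIndex_of_subgroupTwoLogBound {C C' : ℝ} (hC : 0 ≤ C)
    (hC' : 0 ≤ C')
    (hH : ∀ p : ℕ, p.Prime → p ≠ 2 → ∀ u v k : ℕ, 0 < u → 0 < v → u ≠ v → Odd u → Odd v →
      ¬ p ∣ u → ¬ p ∣ v → (2 : ZMod p) ^ k * (v : ZMod p) = (u : ZMod p) →
      (padicValNat p (2 ^ (p - 1) - 1) : ℝ) ≤
        C * orderOf (2 : ZMod p) * Real.log ((max u v : ℕ) : ℝ) * Real.log (2 * ((max u v : ℕ) : ℝ))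
          / (Real.log p) ^ 2 + C')
    {ε : ℝ} (hε : 0 < ε) :
    ∃ δ : ℝ, 0 < δ ∧ ∃ K : ℝ, ∀ p : ℕ, p.Prime → p ≠ 2 →
      Real.log (((p : ℝ) - 1) / (orderOf (2 : ZMod p) : ℝ)) ^ 4 ≤ δ * Real.log p →
      (padicValNat p (2 ^ (p - 1) - 1) : ℝ) * Real.log p
        ≤ ε * (orderOf (2 : ZMod p) : ℝ) * Real.log 2 + K := by
  have hlog2 : 0 < Real.log 2 := Real.log_pos one_lt_two
  -- constants
  set κ : ℝ := ε * Real.log 2 / 2 with hκ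
  have hκ0 : 0 < κ := by positivity
  set δ : ℝ := min 1 (ε * Real.log 2 ^ 3 / (16 * (C + 1))) with hδ
  have hδ0 : 0 < δ := lt_min one_pos (by positivity)
  have hδ1 : δ ≤ 1 := min_le_left _ _
  have hδ2 : δ ≤ ε * Real.log 2 ^ 3 / (16 * (C + 1)) := min_le_right _ _
  set L1 : ℝ := 4096 * C * Real.log 2 / ε with hL1
  set P : ℝ := max 256 (max (Real.exp L1) (51 * C' ^ 2 / κ ^ 2 + 2)) with hP
  have hP256 : (256 : ℝ) ≤ P := le_max_left _ _
  have hPexp : Real.exp L1 ≤ P := le_trans (le_max_left _ _) (le_max_right _ _)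
  have hPT2 : 51 * C' ^ 2 / κ ^ 2 + 2 ≤ P := le_trans (le_max_right _ _) (le_max_right _ _)
  have hP0 : 0 < P := by linarith
  clear_value κ δ L1 P
  refine ⟨δ, hδ0, P * Real.log 2, ?_⟩
  intro p hp hp2 hreg
  haveI : Fact p.Prime := ⟨hp⟩
  -- basic facts about `e = ord_p 2`
  have h2ne0 : (2 : ZMod p) ≠ 0 := by
    intro h
    have : p ∣ 2 := (ZMod.natCast_eq_zero_iff 2 p).mp (by exact_mod_cast h)
    exact hp2 ((Nat.prime_dvd_prime_iff_eq hp Nat.prime_two).mp this)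
  have htriv := soloInformed_wieferichExp_mul_log_lt hp hp2
  set e : ℕ := orderOf (2 : ZMod p) with he
  have hediv : e ∣ p - 1 := ZMod.orderOf_dvd_card_sub_one h2ne0
  clear_value e
  have hp3 : 3 ≤ p := by have := hp.two_le; omega
  have hp1pos : 0 < p - 1 := by omega
  have hepos : 0 < e := Nat.pos_of_dvd_of_pos hediv hp1pos
  have hele : e ≤ p - 1 := Nat.le_of_dvd hp1pos hediv
  have hpR : (3 : ℝ) ≤ (p : ℝ) := by exact_mod_cast hp3
  have hp0 : (0 : ℝ) ≤ (p : ℝ) := by linarith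
  have heR : (0 : ℝ) < (e : ℝ) := by exact_mod_cast hepos
  have hLpos : 0 < Real.log p := Real.log_pos (by linarith)
  -- small primes: absorbed in `K = P log 2` through the trivial bound `W log p < e log 2`
  by_cases hsmall : (p : ℝ) < P
  · have heP : (e : ℝ) ≤ P := by
      have : (e : ℝ) ≤ (p : ℝ) := by exact_mod_cast le_trans hele (Nat.sub_le p 1)
      linarith
    have : (e : ℝ) * Real.log 2 ≤ P * Real.log 2 := mul_le_mul_of_nonneg_right heP hlog2.le
    have h0 : 0 ≤ ε * (e : ℝ) * Real.log 2 := by positivity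
    linarith
  push Not at hsmall
  have hp256 : (256 : ℝ) ≤ p := le_trans hP256 hsmall
  -- the residual index `n = (p-1)/e`
  obtain ⟨n, hne⟩ : ∃ n : ℕ, n * e = p - 1 := ⟨(p - 1) / e, Nat.div_mul_cancel hediv⟩
  have hn1 : 1 ≤ n := by
    rcases Nat.eq_zero_or_pos n with h | h
    · rw [h, zero_mul] at hne; omega
    · exact h
  have hnR : (n : ℝ) = ((p : ℝ) - 1) / (e : ℝ) := by
    rw [eq_div_iff heR.ne']
    have : ((n * e : ℕ) : ℝ) = ((p - 1 : ℕ) : ℝ) := by rw [hne]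
    push_cast at this
    rw [Nat.cast_sub hp.one_le] at this
    push_cast at this
    linarith
  have hnpos : (0 : ℝ) < n := by exact_mod_cast hn1
  have hn1R : (1 : ℝ) ≤ n := by exact_mod_cast hn1
  -- `x = log n`, `t = x / log 2`
  obtain ⟨x, hx⟩ : ∃ x : ℝ, x = Real.log (n : ℝ) := ⟨_, rfl⟩
  have hx0 : 0 ≤ x := by rw [hx]; exact Real.log_nonneg hn1R
  have hreg' : x ^ 4 ≤ δ * Real.log p := by rw [hx, hnR]; exact hreg
  have hx4L : x ^ 4 ≤ Real.log p :=
    le_trans hreg' (le_trans (mul_le_mul_of_nonneg_right hδ1 hLpos.le) (le_of_eq (one_mul _)))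
  obtain ⟨t, ht⟩ : ∃ t : ℝ, t = x / Real.log 2 := ⟨_, rfl⟩
  have htx : t * Real.log 2 = x := by rw [ht]; exact div_mul_cancel₀ x hlog2.ne'
  have ht0 : 0 ≤ t := by rw [ht]; positivity
  have hx4t : x ^ 4 = t ^ 4 * Real.log 2 ^ 4 := by rw [← htx]; ring
  -- `n^4 ≤ 27 p`
  have hn4 : (n : ℝ) ^ 4 ≤ 27 * p := by
    have h4x : 4 * x ≤ Real.log p + 3 := by
      have := soloInformed_four_mul_le_pow_four_add_three x; linarith
    have hexp : Real.exp (4 * x) ≤ Real.exp (Real.log p + 3) := Real.exp_le_exp.mpr h4x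
    rw [Real.exp_add, Real.exp_log (by linarith)] at hexp
    have hn4' : Real.exp (4 * x) = (n : ℝ) ^ 4 := by
      rw [hx, show (4 : ℝ) * Real.log n = ((4 : ℕ) : ℝ) * Real.log n by norm_num,
        Real.exp_nat_mul, Real.exp_log hnpos]
    have he3 : Real.exp 3 ≤ 27 := by
      have h13 : Real.exp 3 = Real.exp 1 ^ 3 := by
        rw [← Real.exp_nat_mul]; norm_num
      rw [h13]
      have h1 := Real.exp_one_lt_three
      calc Real.exp 1 ^ 3 ≤ 3 ^ 3 := by gcongr
        _ = 27 := by norm_num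
    rw [hn4'] at hexp
    calc (n : ℝ) ^ 4 ≤ p * Real.exp 3 := hexp
      _ ≤ p * 27 := mul_le_mul_of_nonneg_left he3 hp0
      _ = 27 * p := by ring
  -- hence `4 n < p` (as `p ≥ 256`)
  have h4n : 4 * (n : ℝ) < p := by
    by_contra h
    push Not at h
    have h1 : (p : ℝ) ^ 4 ≤ 256 * (n : ℝ) ^ 4 := by
      calc (p : ℝ) ^ 4 ≤ (4 * (n : ℝ)) ^ 4 := by gcongr
        _ = 256 * (n : ℝ) ^ 4 := by ring
    have h2 : (256 : ℝ) ^ 3 * p ≤ (p : ℝ) ^ 4 := by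
      calc (256 : ℝ) ^ 3 * p ≤ (p : ℝ) ^ 3 * p := by gcongr
        _ = (p : ℝ) ^ 4 := by ring
    nlinarith
  have h4nN : 4 * n < p := by exact_mod_cast h4n
  -- choose `m` with `2^(m-1) ≤ n < 2^m`
  obtain ⟨m, hm⟩ : ∃ m : ℕ, m = Nat.log 2 n + 1 := ⟨_, rfl⟩
  have hnlt : n < 2 ^ m := by rw [hm]; exact Nat.lt_pow_succ_log_self (by norm_num) n
  have hnge : 2 ^ (m - 1) ≤ n := by
    rw [hm, Nat.add_sub_cancel]; exact Nat.pow_log_le_self 2 (by omega)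
  have hm1 : 1 ≤ m := by rw [hm]; omega
  have hcard : p - 1 < 2 ^ m * e := by
    rw [← hne]; exact Nat.mul_lt_mul_of_pos_right hnlt hepos
  -- the dyadic Bertrand family for this `m`
  obtain ⟨q, hqprime, hqI, hqinj, hq2, hQle⟩ := soloInformed_exists_dyadic_odd_primes m
  have hqp : ∀ j, q j ≠ p := by
    intro j hj
    have h1 : q j ≤ 2 ^ (m + 1) :=
      le_trans (hqI j).2 (Nat.pow_le_pow_right (by norm_num) (by omega))
    have h2 : 2 ^ (m + 1) = 4 * 2 ^ (m - 1) := by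
      obtain ⟨m', hm'⟩ : ∃ m', m = m' + 1 := ⟨Nat.log 2 n, hm⟩
      rw [hm', Nat.add_sub_cancel, pow_succ, pow_succ]; ring
    have : q j < p := by
      calc q j ≤ 2 ^ (m + 1) := h1
        _ = 4 * 2 ^ (m - 1) := h2
        _ ≤ 4 * n := Nat.mul_le_mul_left 4 hnge
        _ < p := h4nN
    omega
  -- the subgroup lever
  have hW := soloInformed_wieferichExp_le_of_subgroupTwoLogBound hC hH hp hp2 q hqprime hq2 hqp
    hqinj (by rw [← he]; exact hcard)
  rw [← he] at hW
  -- `Q ≤ 2^s`, `2 s = m (m+3)`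
  have hs2N := soloInformed_two_mul_sum_fin_add_two m
  obtain ⟨s, hs⟩ : ∃ s : ℕ, s = ∑ j : Fin m, (j.val + 2) := ⟨_, rfl⟩
  rw [← hs] at hQle hs2N
  obtain ⟨Q, hQ⟩ : ∃ Q : ℕ, Q = ∏ j, q j := ⟨_, rfl⟩
  rw [← hQ] at hQle hW
  have hs2 : (2 : ℝ) * s = (m : ℝ) * ((m : ℝ) + 3) := by exact_mod_cast hs2N
  have hQ1 : (1 : ℝ) ≤ (Q : ℝ) := by
    have : 0 < Q := by rw [hQ]; exact Finset.prod_pos (fun j _ => (hqprime j).pos)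
    exact_mod_cast this
  have hlogQ : Real.log (Q : ℝ) ≤ (s : ℝ) * Real.log 2 := by
    have h1 : (Q : ℝ) ≤ (2 : ℝ) ^ s := by exact_mod_cast hQle
    calc Real.log (Q : ℝ) ≤ Real.log ((2 : ℝ) ^ s) := Real.log_le_log (by linarith) h1
      _ = (s : ℝ) * Real.log 2 := by rw [Real.log_pow]
  have hlog2Q : Real.log (2 * (Q : ℝ)) ≤ ((s : ℝ) + 1) * Real.log 2 := by
    rw [Real.log_mul (by norm_num) (by linarith)]; linarith
  have hlogQ0 : 0 ≤ Real.log (Q : ℝ) := Real.log_nonneg hQ1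
  have hlog2Q0 : 0 ≤ Real.log (2 * (Q : ℝ)) := Real.log_nonneg (by linarith)
  -- `m ≤ t + 1`
  have hmt : (m : ℝ) ≤ t + 1 := by
    have h1 : ((2 : ℕ) : ℝ) ^ (m - 1) ≤ (n : ℝ) := by exact_mod_cast hnge
    have h2 : ((m - 1 : ℕ) : ℝ) * Real.log 2 ≤ x := by
      have := Real.log_le_log (by positivity) h1
      rw [Real.log_pow] at this
      push_cast at this
      rw [hx]; exact this
    rw [Nat.cast_sub hm1] at h2
    push_cast at h2
    rw [← htx] at h2
    have := le_of_mul_le_mul_right h2 hlog2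
    linarith
  -- polynomial bookkeeping: `log Q · log 2Q ≤ 4 t^4 (log 2)^2 + 1024 (log 2)^2`
  obtain ⟨y, hy⟩ : ∃ y : ℝ, y = t + 4 := ⟨_, rfl⟩
  have hy4 : 4 ≤ y := by rw [hy]; linarith
  have hy0 : 0 ≤ y := by linarith
  have hsy : (s : ℝ) ≤ y ^ 2 / 2 := by
    have hm0 : (0 : ℝ) ≤ m := Nat.cast_nonneg _
    have hmy : (m : ℝ) ≤ y := by rw [hy]; linarith
    have hm3y : (m : ℝ) + 3 ≤ y := by rw [hy]; linarith
    have hmm : (m : ℝ) * ((m : ℝ) + 3) ≤ y * y := mul_le_mul hmy hm3y (by linarith) hy0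
    have hyy : y ^ 2 = y * y := sq y
    linarith
  have hy16 : (16 : ℝ) ≤ y ^ 2 := by
    have := pow_le_pow_left₀ (by norm_num : (0:ℝ) ≤ 4) hy4 2
    linarith [show ((4:ℝ)) ^ 2 = 16 by norm_num]
  have hs1y : (s : ℝ) + 1 ≤ y ^ 2 := by linarith
  have hs0 : (0 : ℝ) ≤ s := Nat.cast_nonneg _
  have hprod : Real.log (Q : ℝ) * Real.log (2 * (Q : ℝ)) ≤ y ^ 4 * Real.log 2 ^ 2 / 2 := by
    calc Real.log (Q : ℝ) * Real.log (2 * (Q : ℝ))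
        ≤ ((s : ℝ) * Real.log 2) * (((s : ℝ) + 1) * Real.log 2) :=
          mul_le_mul hlogQ hlog2Q hlog2Q0 (by positivity)
      _ = (s : ℝ) * ((s : ℝ) + 1) * Real.log 2 ^ 2 := by ring
      _ ≤ (y ^ 2 / 2) * (y ^ 2) * Real.log 2 ^ 2 := by
          apply mul_le_mul_of_nonneg_right _ (sq_nonneg _)
          exact mul_le_mul hsy hs1y (by positivity) (by positivity)
      _ = y ^ 4 * Real.log 2 ^ 2 / 2 := by ring
  have hy4' : y ^ 4 ≤ 8 * (t ^ 4 + 256) := by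
    -- `(t+4)^4 ≤ 8 (t^4 + 4^4)` since `8(a^4+b^4) - (a+b)^4 = (a-b)^2 (7a^2 + 10ab + 7b^2)`
    have hid : 8 * (t ^ 4 + 256) - (t + 4) ^ 4 = (t - 4) ^ 2 * (7 * t ^ 2 + 40 * t + 112) := by ring
    have hq : 0 ≤ 7 * t ^ 2 + 40 * t + 112 := by nlinarith [sq_nonneg t, ht0]
    have hsq : 0 ≤ (t - 4) ^ 2 * (7 * t ^ 2 + 40 * t + 112) := mul_nonneg (sq_nonneg _) hq
    rw [hy]; linarith
  have hprod' : Real.log (Q : ℝ) * Real.log (2 * (Q : ℝ))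
      ≤ 4 * t ^ 4 * Real.log 2 ^ 2 + 1024 * Real.log 2 ^ 2 := by
    have h := mul_le_mul_of_nonneg_right hy4' (sq_nonneg (Real.log 2))
    linarith
  -- main term: `C e log Q log 2Q / log p ≤ κ e`
  have hLge : L1 ≤ Real.log p := by
    have := Real.log_le_log (Real.exp_pos L1) (le_trans hPexp hsmall)
    rwa [Real.log_exp] at this
  have hmainA : C * (4 * t ^ 4 * Real.log 2 ^ 2) ≤ (ε * Real.log 2 / 4) * Real.log p := by
    -- `t^4 (log 2)^4 = x^4 ≤ δ log p` and `16 C δ ≤ ε (log 2)^3`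
    have h1 : t ^ 4 * Real.log 2 ^ 4 ≤ δ * Real.log p := by rw [← hx4t]; exact hreg'
    have h2 : C * δ ≤ ε * Real.log 2 ^ 3 / 16 := by
      have hC1 : 0 < C + 1 := by linarith
      have h2a : C * δ ≤ C * (ε * Real.log 2 ^ 3 / (16 * (C + 1))) :=
        mul_le_mul_of_nonneg_left hδ2 hC
      have h2b : C * (ε * Real.log 2 ^ 3 / (16 * (C + 1)))
          = (ε * Real.log 2 ^ 3 / 16) * (C / (C + 1)) := by
        rw [div_mul_div_comm]
        ring
      have h2c : C / (C + 1) ≤ 1 := div_le_one_of_le₀ (by linarith) hC1.le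
      have h2d : (ε * Real.log 2 ^ 3 / 16) * (C / (C + 1)) ≤ ε * Real.log 2 ^ 3 / 16 :=
        mul_le_of_le_one_right (by positivity) h2c
      linarith
    -- `4 C t^4 log2^4 ≤ 4 C δ log p ≤ (ε log2^3 / 4) log p`; divide by `log2^2`
    have h3 : 4 * C * (t ^ 4 * Real.log 2 ^ 4) ≤ 4 * C * (δ * Real.log p) :=
      mul_le_mul_of_nonneg_left h1 (by positivity)
    have h4 : 4 * C * (δ * Real.log p) ≤ (ε * Real.log 2 ^ 3 / 4) * Real.log p := by
      have := mul_le_mul_of_nonneg_right h2 hLpos.le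
      nlinarith
    have h5 : 4 * C * (t ^ 4 * Real.log 2 ^ 4) ≤ (ε * Real.log 2 ^ 3 / 4) * Real.log p :=
      le_trans h3 h4
    have hl2 : 0 < Real.log 2 ^ 2 := by positivity
    have e1 : C * (4 * t ^ 4 * Real.log 2 ^ 2)
        = (4 * C * (t ^ 4 * Real.log 2 ^ 4)) / Real.log 2 ^ 2 := by
      rw [eq_div_iff hl2.ne']; ring
    have e2 : (ε * Real.log 2 / 4) * Real.log p
        = ((ε * Real.log 2 ^ 3 / 4) * Real.log p) / Real.log 2 ^ 2 := by
      rw [eq_div_iff hl2.ne']; ring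
    rw [e1, e2]
    exact div_le_div_of_nonneg_right h5 hl2.le
  have hmainB : C * (1024 * Real.log 2 ^ 2) ≤ (ε * Real.log 2 / 4) * Real.log p := by
    have h1 : 4096 * C * Real.log 2 ≤ ε * Real.log p := by
      have h := mul_le_mul_of_nonneg_left hLge hε.le
      rw [hL1, mul_div_cancel₀ _ hε.ne'] at h
      exact h
    calc C * (1024 * Real.log 2 ^ 2) = (Real.log 2 / 4) * (4096 * C * Real.log 2) := by ring
      _ ≤ (Real.log 2 / 4) * (ε * Real.log p) := mul_le_mul_of_nonneg_left h1 (by positivity)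
      _ = (ε * Real.log 2 / 4) * Real.log p := by ring
  have hmain : C * (e : ℝ) * Real.log (Q : ℝ) * Real.log (2 * (Q : ℝ)) / Real.log p
      ≤ κ * e := by
    rw [div_le_iff₀ hLpos]
    have h1 : C * (Real.log (Q : ℝ) * Real.log (2 * (Q : ℝ))) ≤ (ε * Real.log 2 / 2) * Real.log p := by
      calc C * (Real.log (Q : ℝ) * Real.log (2 * (Q : ℝ)))
          ≤ C * (4 * t ^ 4 * Real.log 2 ^ 2 + 1024 * Real.log 2 ^ 2) :=
            mul_le_mul_of_nonneg_left hprod' hC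
        _ = C * (4 * t ^ 4 * Real.log 2 ^ 2) + C * (1024 * Real.log 2 ^ 2) := by ring
        _ ≤ (ε * Real.log 2 / 4) * Real.log p + (ε * Real.log 2 / 4) * Real.log p :=
            add_le_add hmainA hmainB
        _ = (ε * Real.log 2 / 2) * Real.log p := by ring
    have h2 := mul_le_mul_of_nonneg_left h1 heR.le
    calc C * (e : ℝ) * Real.log (Q : ℝ) * Real.log (2 * (Q : ℝ))
        = (e : ℝ) * (C * (Real.log (Q : ℝ) * Real.log (2 * (Q : ℝ)))) := by ring
      _ ≤ (e : ℝ) * ((ε * Real.log 2 / 2) * Real.log p) := h2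
      _ = κ * e * Real.log p := by rw [hκ]; ring
  -- additive term: `C' log p ≤ κ e`, via `(log p · n)^4 ≤ 648 p^2` and `p - 1 ≥ 51 C'^2/κ^2`
  have hL4 : Real.log p ^ 4 ≤ 24 * p := by
    have h := Real.pow_div_factorial_le_exp (Real.log p) hLpos.le 4
    rw [Real.exp_log (by linarith)] at h
    have h24 : ((4 : ℕ).factorial : ℝ) = 24 := by norm_num [Nat.factorial]
    rw [h24, div_le_iff₀ (by norm_num : (0:ℝ) < 24)] at h
    linarith
  have hp1ne : (p : ℝ) - 1 ≠ 0 := by linarith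
  have hadd : C' * Real.log p ≤ κ * e := by
    have heq : (e : ℝ) = ((p : ℝ) - 1) / n := by
      rw [hnR, div_div_eq_mul_div, mul_div_cancel_left₀ _ hp1ne]
    rw [heq, mul_div_assoc', le_div_iff₀ hnpos]
    have hA : (C' * Real.log p * n) ^ 4 ≤ C' ^ 4 * (648 * (p : ℝ) ^ 2) := by
      have h1 : (C' * Real.log p * n) ^ 4 = C' ^ 4 * (Real.log p ^ 4 * (n : ℝ) ^ 4) := by ring
      rw [h1]
      apply mul_le_mul_of_nonneg_left _ (by positivity)
      calc Real.log p ^ 4 * (n : ℝ) ^ 4 ≤ (24 * p) * (27 * p) :=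
            mul_le_mul hL4 hn4 (by positivity) (by positivity)
        _ = 648 * (p : ℝ) ^ 2 := by ring
    have hB : C' ^ 4 * (648 * (p : ℝ) ^ 2) ≤ (κ * ((p : ℝ) - 1)) ^ 4 := by
      have hp1 : 51 * C' ^ 2 / κ ^ 2 ≤ (p : ℝ) - 1 := by linarith [le_trans hPT2 hsmall]
      have hκ2 : 0 < κ ^ 2 := by positivity
      have h1 : 51 * C' ^ 2 ≤ κ ^ 2 * ((p : ℝ) - 1) := by
        rw [div_le_iff₀ hκ2] at hp1; linarith
      have hp1' : (1 : ℝ) ≤ (p : ℝ) - 1 := by linarith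
      have h2a : (p : ℝ) ≤ 2 * ((p : ℝ) - 1) := by linarith
      have h2 : (p : ℝ) ^ 2 ≤ 4 * ((p : ℝ) - 1) ^ 2 := by
        calc (p : ℝ) ^ 2 ≤ (2 * ((p : ℝ) - 1)) ^ 2 := by gcongr
          _ = 4 * ((p : ℝ) - 1) ^ 2 := by ring
      have h51 : (51 * C' ^ 2) ^ 2 ≤ (κ ^ 2 * ((p : ℝ) - 1)) ^ 2 :=
        pow_le_pow_left₀ (by positivity) h1 2
      calc C' ^ 4 * (648 * (p : ℝ) ^ 2) ≤ C' ^ 4 * (2592 * ((p : ℝ) - 1) ^ 2) := by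
            apply mul_le_mul_of_nonneg_left _ (by positivity); linarith
        _ = (2592 / 2601) * (51 * C' ^ 2) ^ 2 * ((p : ℝ) - 1) ^ 2 := by ring
        _ ≤ (2592 / 2601) * (κ ^ 2 * ((p : ℝ) - 1)) ^ 2 * ((p : ℝ) - 1) ^ 2 := by
            apply mul_le_mul_of_nonneg_right _ (by positivity)
            exact mul_le_mul_of_nonneg_left h51 (by norm_num)
        _ ≤ 1 * (κ ^ 2 * ((p : ℝ) - 1)) ^ 2 * ((p : ℝ) - 1) ^ 2 := by
            apply mul_le_mul_of_nonneg_right _ (by positivity)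
            apply mul_le_mul_of_nonneg_right _ (by positivity)
            norm_num
        _ = (κ * ((p : ℝ) - 1)) ^ 4 := by ring
    have hC'n : 0 ≤ C' * Real.log p * n := by positivity
    have hκp : 0 ≤ κ * ((p : ℝ) - 1) := mul_nonneg hκ0.le (by linarith)
    exact (pow_le_pow_iff_left₀ hC'n hκp (by norm_num : (4:ℕ) ≠ 0)).mp (le_trans hA hB)
  -- assemble
  have hK0 : 0 ≤ P * Real.log 2 := by positivity
  have hfinal : (padicValNat p (2 ^ (p - 1) - 1) : ℝ) * Real.log p
      ≤ C * (e : ℝ) * Real.log (Q : ℝ) * Real.log (2 * (Q : ℝ)) / Real.log p + C' * Real.log p := by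
    have h := mul_le_mul_of_nonneg_right hW hLpos.le
    rw [add_mul, div_mul_eq_mul_div, pow_two, mul_div_mul_right _ _ hLpos.ne'] at h
    exact h
  calc (padicValNat p (2 ^ (p - 1) - 1) : ℝ) * Real.log p
      ≤ C * (e : ℝ) * Real.log (Q : ℝ) * Real.log (2 * (Q : ℝ)) / Real.log p + C' * Real.log p := hfinal
    _ ≤ κ * e + κ * e := add_le_add hmain hadd
    _ = ε * (e : ℝ) * Real.log 2 := by rw [hκ]; ring
    _ ≤ ε * (e : ℝ) * Real.log 2 + P * Real.log 2 := by linarith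

end Summit.ABC.ABC.Theorems
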